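import Literature.MathematicalPhysics.QuantumFieldTheory.Balaban1983to89.Step
import Literature.MathematicalPhysics.QuantumFieldTheory.Balaban1983to89.FlowStep

/-!
# K0⁷ V23 — STUB-3 TERM SIZES (D1′): lens-2's `TermSizes` ∕ `Bound118` BY NAME, and the honest record-side shape of
# `termSizesOfRecord` = a SOCKET over a print TOWER DATUM, `termSizesOfTower`, with print's (1.18) (`Step.SFHyp.bound118`) ⟹ `Bound118`

Cell `ym-nodeO-ideate`, DEFINER seat `ym-nodeO-def-1` (gen 32), answering director-ym №405 (2)(iii) («D1′ (`TermSizes` of record) TYPED as a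
record-side definition — DEF-1: take it on lens-2's spec»; pub-ymgap bus 2026-08-30T17:57:30Z).  `--kind definition --supports stmt-QuantumFields-20541
--as helper`; count-neutral.  [I] = [Balaban1987RG1].

LOCATED (nodeO STATUS l.3289).  The record's term family is the WHOLE merged new term `𝓝_{k+1}` per `(k, hist, K)` (`Node00/BetaOfRecord` `betaMerged`,
design (β)); no Node00 module types a localization-domain decomposition `Σ_X E^{(k)}(X, g_{k−1}, 𝐔, 𝐉)` of it.  The (1.7) representation with its
analyticity domains is typed only on the PRINT side: `Step.SFTower` (`sys : ℕ → LocDomainSys`, `E`, `space`) with `Step.SFHyp.bound118` = [I] (1.18).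
So lens-2's «sup over the analyticity domain, taken by the record side» ranges over a TOWER DATUM, and the honest D1′ is the socket below; «of record»
is then `termSizesOfTower (T_rec F a₀ ε₂₉) c` for a tower whose `Etot` re-sums to the record's merged term — a HYPOTHESIS nobody holds (NODE O's
representation theorem), which is why lens-2's rows keep `D` as a binder.

CONTENTS.  §1 `TermSizes`, `Bound118`, `bound118_mono` — lens-2's `nodeO-cover/LENS-2-Sketch-v3.lean` :455–:470 VERBATIM (so line files import
them by name).  §2 ★ `termSizesOfTower T c` (level shift: lens-2's level-`k` term = print's `E^{(k+1)}(X, g_k, ·)`; the size reads only the last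
coupling `v (Fin.last k)` — print's `E^{(j)}` depends on `g_{j−1}` alone; sup of `‖E‖` over `T.space (k+1) X c.α₀ c.α₁`, `Real.sSup` convention `sSup ∅ = 0`)
and ★ `bound118_termSizesOfTower_of_SFHyp`: `Step.SFHyp T c K` ⟹ `Bound118 (termSizesOfTower T c) c.κ k v c.E₀` for every `k + 1 ≤ K` and every
box history `v ∈ Box c.γ k` — print's (1.18) IS lens-2's row-E predicate for the tower's sizes, constant `E₀` uniform in `k`.

HONEST FRAMING.  Two definitions asserting nothing and one unfolding lemma; NO tower of record is constructed or claimed; nothing of Bałaban's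
[I] Thm 2 ∕ (1.18) reproduction is asserted; K0⁷ `Record13SepCoPHInhabited` NOT closed; NODE O not inhabited (objects 0∕1); COUNT 8∕28 · K 1∕4
UNMOVED; finite `𝕋⁴_{L^K}` at fixed ε — NOT continuum ∕ ℝ⁴ ∕ OS; **the Yang–Mills mass gap (Clay) is NOT proved by any of this.**
No `sorry`, `instance`, `notation`; standard axioms.
-/

noncomputable section

namespace Summit.QuantumFields.YangMills.Theorems.K0V23Stub3TermSizes

open Literature.MathematicalPhysics.QuantumFieldTheory.Balaban1983to89
open Literature.MathematicalPhysics.QuantumFieldTheory.Balaban1983to89.FlowStep (Box mem_box)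

/-! ## §1  lens-2's size data and the (1.18) predicate (verbatim) -/

/-- The localized-term SIZE DATA of a tower, per level and coupling history (lens-2 «flow-gronwall-ttel», `LENS-2-Sketch-v3.lean` :455, verbatim):
localization domains `ι k`, tree length `d k X`, and the size `a k v X` of the level-`k` localized term on `X` for the coupling history `v`
(sup over the analyticity domain). (A datum asserting nothing; locators [I] (1.7) p.261, (1.18) p.263.) -/
structure TermSizes where
  /-- localization domains at level `k` -/
  ι : ℕ → Type
  /-- tree length `d_k(X)` -/
  d : (k : ℕ) → ι k → ℝ
  /-- size of the level-`k` localized term on `X` for the coupling history `v` (sup over the analyticity domain) -/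
  a : (k : ℕ) → (Fin (k + 1) → ℝ) → ι k → ℝ

/-- **(1.18) at level `k` with constant `E`** for the history `v`: `a_k(v, X) ≤ E · exp(−κ d_k(X))` for every domain `X` (lens-2 verbatim).
[cite: Balaban1987RG1, (1.18) p.263] -/
def Bound118 (D : TermSizes) (κ : ℝ) (k : ℕ) (v : Fin (k + 1) → ℝ) (E : ℝ) : Prop :=
  ∀ X : D.ι k, D.a k v X ≤ E * Real.exp (-κ * D.d k X)

/-- Monotonicity of (1.18) in the constant (lens-2 verbatim). [cite: Balaban1987RG1, (1.18) p.263 (bookkeeping)] -/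
theorem bound118_mono {D : TermSizes} {κ : ℝ} {k : ℕ} {v : Fin (k + 1) → ℝ} {E E' : ℝ} (hE : E ≤ E')
    (h : Bound118 D κ k v E) : Bound118 D κ k v E' :=
  fun X => (h X).trans (mul_le_mul_of_nonneg_right hE (Real.exp_nonneg _))

/-! ## §2  D1′, honest shape: the term sizes OF A PRINT TOWER (socket over the (1.7) representation datum), and (1.18) ⟹ `Bound118` -/

variable {P : Params} {G : Type*} [GaugeGroup G] {Φ 𝒢 : Type*}

/-- **★ `termSizesOfTower T c`** — the `TermSizes` of a small-field tower `T : Step.SFTower` ([I] §1) at the constants `c`: domains `(T.sys (k+1)).Dom`,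
tree lengths `(T.sys (k+1)).dj`, and size of the level-`k` term = `sup_{φ ∈ U^c_{k+1}(X, α₀, α₁)} ‖E^{(k+1)}(X, g_k, φ)‖` with `g_k := v (Fin.last k)`
(print's `E^{(j)}` reads `g_{j−1}` only; `Real.sSup`, so an empty or unbounded range reads `0`).  A definition asserting nothing; «of record» needs a
tower datum for the record's merged terms, which the tree does not hold. [cite: Balaban1987RG1, (1.7) p.261, (1.18) p.263, p.262 (i)–(iv)] -/
def termSizesOfTower (T : Step.SFTower P G Φ 𝒢) (c : Step.SFConsts) : TermSizes where
  ι := fun k => (T.sys (k + 1)).Dom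
  d := fun k X => (T.sys (k + 1)).dj X
  a := fun k v X => sSup ((fun φ => ‖T.E (k + 1) X (v (Fin.last k)) φ‖) '' T.space (k + 1) X c.α₀ c.α₁)

/-- Unfolding (`rfl`) of the size field. [cite: Balaban1987RG1, (1.7) p.261 (bookkeeping)] -/
theorem termSizesOfTower_a (T : Step.SFTower P G Φ 𝒢) (c : Step.SFConsts) (k : ℕ) (v : Fin (k + 1) → ℝ) (X : (T.sys (k + 1)).Dom) :
    (termSizesOfTower T c).a k v X = sSup ((fun φ => ‖T.E (k + 1) X (v (Fin.last k)) φ‖) '' T.space (k + 1) X c.α₀ c.α₁) := rfl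

/-- **★ PRINT's (1.18) ⟹ lens-2's `Bound118` FOR THE TOWER's SIZES, constant `E₀` uniform in the level**: if the small-field hypotheses `Step.SFHyp T c K`
hold up to scale `K` and `0 ≤ E₀`, then for every level `k` with `k + 1 ≤ K` and every box history `v ∈ Box c.γ k` (so `0 < g_k ≤ γ`),
`Bound118 (termSizesOfTower T c) c.κ k v c.E₀`. (`Real.sSup_le` over the image of the analyticity domain, fed by `SFHyp.bound118`.)
[cite: Balaban1987RG1, (1.18) p.263] -/
theorem bound118_termSizesOfTower_of_SFHyp {T : Step.SFTower P G Φ 𝒢} {c : Step.SFConsts} {K : ℕ} (h : Step.SFHyp T c K)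
    (hE : 0 ≤ c.E₀) {k : ℕ} (hk : k + 1 ≤ K) {v : Fin (k + 1) → ℝ} (hv : v ∈ Box c.γ k) :
    Bound118 (termSizesOfTower T c) c.κ k v c.E₀ := by
  intro X
  have hg := (mem_box.mp hv) (Fin.last k)
  refine Real.sSup_le ?_ (mul_nonneg hE (Real.exp_nonneg _))
  rintro _ ⟨φ, hφ, rfl⟩
  exact h.bound118 (k + 1) (Nat.succ_pos k) hk X (v (Fin.last k)) φ hg.1.le hg.2 hφ

end Summit.QuantumFields.YangMills.Theorems.K0V23Stub3TermSizes

end
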